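import Summits.BirchSwinnertonDyer.Rank1Residual.X2.RankZero
import Literature.NumberTheory.EllipticCurves.CyclotomicPAdicHeight
import HarnessLib

/-!
# Rank `0` at a multiplicative prime: the Stein–Wuthrich §4.2 height datum is the ZERO pairing —
# the two height-existence named facts DISCHARGED on every rank-`0` consumer (cell `b2b-bsdres`, unit `b2b-bsdres-x11a`, gen 18)

HONEST FRAMING (run/shared/lean/b2b/bsd-rank1-residual/, verbatim in every file): the goal of the
cell is to DELETE the COMBINATION-SHAPED residual classes of the Birch–Swinnerton-Dyer formula for
ALL analytic-rank `≤ 1` elliptic curves over `ℚ` — "full BSD formula for every rank `≤ 1` curve in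
class `C`" assembled STRICTLY from published theorems — so that the rank-`≤ 1` remainder becomes
exactly the CONSTRUCTION-SHAPED classes, which are TYPED (missing-input `Prop`s), NOT attempted.
This is not "finishing BSD". Research route; NO CLAIM BEYOND STATED CLASSES. No label change is
made by this file (cell lead / referee).

## What is removed, and why it is legitimate

Every rank-`0` consumer of Stein–Wuthrich 2013 Thm. 6.1 at a multiplicative prime in the tree
(`Typed.bsdp_of_multCharIdeal_{split,nonsplit}_rankZero`, x11a gen 8, and everything above it:
`X2.bsdp_of_mazurMainConjectureAt_of_analyticRank_eq_zero`, `X2.targetA_of_published`, the X11a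
chain `X11a.forall_bsdp_of_namedFacts{,_mtt,…}`) carries the two NAMED FACTS
`SteinWuthrich2013.exists_isSplitMultCanonical` / `exists_isMultCanonical` (existence of THE §4.2
`p`-adic height datum = Schneider's pairing; PUB, unproved) — used ONLY to exhibit SOME datum `Dh`
with `IsSplitMultCanonical Dh Dq` (resp. `IsMultCanonical Dh q`) to feed Thm. 6.1, AFTER the proof
has established `Finite E(ℚ)` (analytic rank `0` ⇒ rank `0`, Gross–Zagier–Kolyvagin `hGZK`).  On a
finite `E(ℚ)` every point has finite order, so NO point is admissible
(`IsAdmissible p P := ¬ IsOfFinAddOrder P ∧ …`) and `IsMultCanonical Dh q := ∀ P, IsAdmissible P → …`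
/ `IsSplitMultCanonical Dh Dq` hold for the ZERO pairing `PAdicHeightData.zero W p` — which is THE
datum by the tree's uniqueness theorem `IsMultCanonical.unique` (a symmetric bilinear
torsion-vanishing pairing on a finite group is zero; `Reg_p = det(∅) = 1`, as the existing proofs
already use via `padicRegulator_eq_one_of_finite`).  Hence at analytic rank `0` the existence facts
are THEOREMS, and this file re-issues the rank-`0` glue WITHOUT the binders `hH`/`hHs`/`hHn`:

* `exists_is{,Split}MultCanonical_of_finite` (+ `…_zero_…`, `eq_zero_of_…`): the datum on a finite `E(ℚ)`;
* `bsdp_of_multCharIdeal_{nonsplit,split}_rankZero_heightFree`: the gen-8 rank-`0` glue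
  (main-conjecture EQUALITY ⇒ `BSD(E,p)`), proofs adapted verbatim from
  `Literature/…/Typed/MultiplicativeRankZero.lean`, the line `obtain ⟨Dh, hDh⟩ := hH …` replaced by
  the zero datum;
* `X2.bsdp_of_mazurMainConjectureAt_of_analyticRank_eq_zero_heightFree` (adapted from
  `X2/RankZero.lean`, eisenstein-p2): Mazur's main conjecture at a rank-`0` pair ⇒ `BSD(E,p)` from
  Stein–Wuthrich Thm. 6.1, Greenberg–Stevens, GZK and modularity ONLY;
* `X2.targetA_of_published_heightFree`: sub-cell X2a closed from published facts, TWO FEWER binders.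

The X11a chain of record with 14 (not 16) named facts is re-issued in `X11a/ChainHeightFree.lean`.
The named facts themselves stay in the tree unchanged (load-bearing for RANK-ONE consumers, where
admissible points exist). References: Stein–Wuthrich, Math. Comp. 82 (2013) Thm. 6.1, §4.1–4.2
[SteinWuthrich2013]; Mazur–Stein–Tate 2006 §1 [MazurSteinTate2006]; Greenberg–Stevens 1993
[GreenbergStevens1993]; Mazur–Tate–Teitelbaum 1986 §I.14, §II.4 [MazurTateTeitelbaum1986]; Miller
2011 Def. 1.1 [Miller2011LMS].
-/

set_option autoImplicit false

noncomputable section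

open scoped Classical MatrixGroups ModularForm

open CongruenceSubgroup WeierstrassCurve Literature.NumberTheory.EllipticCurves
  Literature.NumberTheory.EllipticCurves.ModularForms
  Literature.NumberTheory.EllipticCurves.Rank1Residual
  Literature.NumberTheory.EllipticCurves.Rank1Residual.Typed
  Literature.NumberTheory.EllipticCurves.GreenbergVatsal2000
  Literature.NumberTheory.EllipticCurves.Wuthrich2014
  Literature.NumberTheory.EllipticCurves.SteinWuthrich2013

namespace Summit.BirchSwinnertonDyer.Rank1Residual.RankZeroHeightFree

/-! ### The §4.2 datum on a finite Mordell–Weil group is the zero pairing -/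

section Datum

variable (W : WeierstrassCurve ℚ) (p : ℕ) [Fact p.Prime]

/-- On a finite `E(ℚ)` no point is admissible (admissible points are non-torsion by definition).
[Mazur–Stein–Tate 2006, §1] [folklore] -/
theorem not_isAdmissible_of_finite [Finite W.toAffine.Point] (P : W.toAffine.Point) :
    ¬ W.IsAdmissible p P :=
  fun h => h.1 (isOfFinAddOrder_of_finite P)

/-- On a finite `E(ℚ)` the zero pairing IS the Stein–Wuthrich §4.2 datum at a non-split
multiplicative prime (the defining condition quantifies over admissible points, of which there are
none). [Stein–Wuthrich 2013, §4.2 (p. 15)] [folklore] -/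
theorem isMultCanonical_zero_of_finite [Finite W.toAffine.Point] (q : ℚ_[p]) :
    IsMultCanonical (PAdicHeightData.zero W p) q :=
  fun P hP => (not_isAdmissible_of_finite W p P hP).elim

/-- On a finite `E(ℚ)` the zero pairing IS the Stein–Wuthrich §4.2 datum at a split multiplicative
prime. [Stein–Wuthrich 2013, §4.2 (p. 16)] [folklore] -/
theorem isSplitMultCanonical_zero_of_finite [W.IsElliptic] [Finite W.toAffine.Point]
    (Dq : TateParameterData W p) : IsSplitMultCanonical (PAdicHeightData.zero W p) Dq :=
  fun P hP => (not_isAdmissible_of_finite W p P hP).elim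

/-- **Existence of THE §4.2 datum at a non-split multiplicative prime, for finite `E(ℚ)`** — the
instance of the named fact `SteinWuthrich2013.exists_isMultCanonical` that the rank-`0` consumers
use, now a theorem. [Stein–Wuthrich 2013, §4.2 (p. 15)] [folklore] -/
theorem exists_isMultCanonical_of_finite [Finite W.toAffine.Point] (q : ℚ_[p]) :
    ∃ Dh : PAdicHeightData W p, IsMultCanonical Dh q :=
  ⟨PAdicHeightData.zero W p, isMultCanonical_zero_of_finite W p q⟩

/-- **Existence of THE §4.2 datum at a split multiplicative prime, for finite `E(ℚ)`** — the
instance of `SteinWuthrich2013.exists_isSplitMultCanonical` that the rank-`0` consumers use, now a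
theorem. [Stein–Wuthrich 2013, §4.2 (p. 16)] [folklore] -/
theorem exists_isSplitMultCanonical_of_finite [W.IsElliptic] [Finite W.toAffine.Point]
    (Dq : TateParameterData W p) : ∃ Dh : PAdicHeightData W p, IsSplitMultCanonical Dh Dq :=
  ⟨PAdicHeightData.zero W p, isSplitMultCanonical_zero_of_finite W p Dq⟩

variable {W p} in
/-- Uniqueness makes it THE datum: any §4.2 datum on a finite `E(ℚ)` (non-split prime) is the zero
pairing (`IsMultCanonical.unique`, SW §4). [Stein–Wuthrich 2013, §4 (p. 14) and §4.2] [folklore] -/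
theorem eq_zero_of_isMultCanonical_of_finite [W.IsElliptic] [W.IsGloballyMinimal]
    [Finite W.toAffine.Point] {Dh : PAdicHeightData W p} {q : ℚ_[p]} (h : IsMultCanonical Dh q) :
    Dh = PAdicHeightData.zero W p :=
  h.unique (isMultCanonical_zero_of_finite W p q)

variable {W p} in
/-- Uniqueness, split prime: any §4.2 datum on a finite `E(ℚ)` is the zero pairing
(`IsSplitMultCanonical.unique`). [Stein–Wuthrich 2013, §4.2 (p. 16)] [folklore] -/
theorem eq_zero_of_isSplitMultCanonical_of_finite [W.IsElliptic] [W.IsGloballyMinimal]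
    [Finite W.toAffine.Point] {Dh : PAdicHeightData W p} {Dq : TateParameterData W p}
    (h : IsSplitMultCanonical Dh Dq) : Dh = PAdicHeightData.zero W p :=
  h.unique (isSplitMultCanonical_zero_of_finite W p Dq)

/-- At analytic rank `0`, `E(ℚ)` is finite (Gross–Zagier–Kolyvagin, the named fact `hGZK`; the
tree's `mordellWeilRank_eq_zero_iff_finite`). [Kolyvagin 1990; Gross–Zagier 1986] [folklore] -/
theorem finite_point_of_analyticRank_eq_zero [W.IsElliptic]
    (hGZK : rank_eq_analyticRank_of_analyticRank_le_one) (hr : W.analyticRank = 0) :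
    Finite W.toAffine.Point := by
  obtain ⟨hrank, -⟩ := hGZK W (by omega)
  exact W.mordellWeilRank_eq_zero_iff_finite.mp (by rw [hrank, hr])

end Datum

/-! ### The rank-`0` glue without the height-existence binder (adapted from `Typed/MultiplicativeRankZero.lean`, x11a gen 8) -/

/-- **Rank `0`, NON-split multiplicative `p ≠ 2`: `BSD(E,p)` from the main-conjecture EQUALITY —
WITHOUT the height-existence fact.** Verbatim `Typed.bsdp_of_multCharIdeal_nonsplit_rankZero`
(Stein–Wuthrich Thm. 6.1 `hJ`, GZK `hGZK`, modularity `hmod`; data: Tate parameter, cyclotomic data,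
newform, dual datum, period ratio `ϖ`, THE non-split `p`-adic `L`-function; the EQUALITY `hMC`),
except that THE §4.2 height datum fed to Thm. 6.1 is the zero pairing
(`exists_isMultCanonical_of_finite`: `E(ℚ)` is finite in rank `0`), so the binder
`hH : exists_isMultCanonical` is gone. Chain as there: `g(0)·w(0) = ϖ·L(0) = 2ϖ[0]⁺_f`; Thm. 6.1
clause 3 with `Reg_p = 1`; valuations; `bsdp_of_padicValRat_rank_zero`.
-- adapted from Literature/NumberTheory/EllipticCurves/Rank1Residual/Typed/MultiplicativeRankZero.lean
[cite: SteinWuthrich2013, Thm. 6.1 (p. 20) and §4.2 (p. 15)] [cite: MazurTateTeitelbaum1986, §I.14]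
[cite: GreenbergLNM1716, §4 (PDF p. 113)] [cite: Miller2011LMS, Def. 1.1 and §1] -/
theorem bsdp_of_multCharIdeal_nonsplit_rankZero_heightFree (hJ : thm61_nonsplitMultiplicative)
    (hGZK : rank_eq_analyticRank_of_analyticRank_le_one)
    (hmod : hasEntireLFunction_rat)
    (W : WeierstrassCurve ℚ) [W.IsElliptic] [W.IsGloballyMinimal] (p : ℕ) [Fact p.Prime]
    {κ : ZpExtension ℚ p} {γ : Field.absoluteGaloisGroup ℚ} {N : ℕ} [NeZero N]
    {f : CuspForm (Gamma0 N) 2} (hp : p ≠ 2) (hr : W.analyticRank = 0)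
    (hmult : W.HasMultiplicativeReductionAtPrime p)
    (hns : ¬ W.HasSplitMultiplicativeReductionAtPrime p)
    {q : ℚ_[p]} (hq0 : q ≠ 0) (hq1 : ‖q‖ < 1) (hqj : tateJ q = (W.j : ℚ_[p]))
    (hκ : κ.IsCyclotomic) (hγ : κ.IsTopGenerator γ) (hγ' : IsCyclotomicVariable p γ)
    (hf : IsNewformOf W f) (D : W.SelmerDualData κ γ) (ϖ : ℚ) (hϖ0 : ϖ ≠ 0)
    (hϖ : (ϖ : ℝ) * W.realPeriodRat = plusPeriod f)
    (L : PowerSeries ℚ_[p]) (hL : IsMultPAdicLFunctionOf f p (-1) L)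
    (hMC : D.IsTorsion ∧ ∃ (g : IwasawaAlgebra p) (w : (IwasawaAlgebra p)ˣ),
      D.charIdeal = Ideal.span {g} ∧
      iwasawaToPowerSeries p (g * (w : IwasawaAlgebra p)) = PowerSeries.C ((ϖ : ℚ) : ℚ_[p]) * L) :
    BSDp W p := by
  have hpP : p.Prime := Fact.out
  haveI : Module.Finite (IwasawaAlgebra p) D.X := D.module_finite_holds hγ
  obtain ⟨hX, g, w, hchar, hw⟩ := hMC
  -- `L(E,1) ≠ 0`, rank `0`, `Ш` finite, `E(ℚ)` finite
  have hL1 : W.entireLFunction 1 ≠ 0 := (W.analyticRank_eq_zero_iff_holds (hmod W)).1 hr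
  obtain ⟨hrank, hfin⟩ := hGZK W (by omega)
  have hr0 : W.mordellWeilRank = 0 := by rw [hrank, hr]
  haveI : Finite W.toAffine.Point := W.mordellWeilRank_eq_zero_iff_finite.mp hr0
  haveI : Finite W.sha := hfin
  haveI : Finite (AddCommGroup.primaryComponent W.sha p) := inferInstance
  -- the rational `t = ϖ · [0]⁺_f = L(E,1)/Ω_E`
  set s : ℚ := ratPlusSymbol f 0 with hs_def
  set t : ℚ := ϖ * s with ht_def
  have hΩpos : 0 < W.realPeriodRat := W.realPeriodRat_pos_holds
  have hLval : W.entireLFunction 1 = (((s : ℝ) * plusPeriod f : ℝ) : ℂ) := hf.entireLFunction_one_eq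
  have hq : W.entireLFunction 1 / (W.realPeriodRat : ℂ) = ((t : ℚ) : ℂ) := by
    rw [hLval, ← hϖ, div_eq_iff (Complex.ofReal_ne_zero.mpr hΩpos.ne'), ht_def]
    push_cast
    ring
  have hs0 : s ≠ 0 := by
    intro h0
    apply hL1
    rw [hLval, h0]
    simp
  have ht0 : t ≠ 0 := mul_ne_zero hϖ0 hs0
  -- THE height datum IS the zero pairing in rank `0` (no admissible point); `Reg_p = 1`
  obtain ⟨Dh, hDh⟩ := exists_isMultCanonical_of_finite W p q
  have hReg : padicRegulator Dh = 1 := padicRegulator_eq_one_of_finite W p Dh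
  have hSch : SchneiderConjecture Dh := by
    rw [SchneiderConjecture, hReg]
    exact one_ne_zero
  -- Stein–Wuthrich Thm. 6.1, clause 3, in rank `0`
  obtain ⟨-, -, h3⟩ := hJ W p hp hmult hns q hq0 hq1 hqj κ γ hκ hγ hγ' D hX g hchar Dh hDh
  obtain ⟨u, hu⟩ := h3 hSch inferInstance
  simp only [hr0, pow_zero, mul_one, hReg, PowerSeries.coeff_zero_eq_constantCoeff] at hu
  -- constant coefficients of `ι(g · w) = ϖ · L`: `g(0) · w(0) = ϖ · 2 [0]⁺_f`
  have hL0 : PowerSeries.constantCoeff L = 2 * (s : ℚ_[p]) := hL.constantCoeff_of_neg_one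
  have hgw : PowerSeries.constantCoeff (g * (w : IwasawaAlgebra p)) =
      PowerSeries.constantCoeff g * PowerSeries.constantCoeff (w : IwasawaAlgebra p) := map_mul _ _ _
  have h0 := congrArg PowerSeries.constantCoeff hw
  rw [constantCoeff_iwasawaToPowerSeries, hgw, PadicInt.coe_mul, map_mul,
    PowerSeries.constantCoeff_C, hL0] at h0
  -- `w(0)` is a unit of `ℤ_p`
  have hwu : IsUnit (PowerSeries.constantCoeff (w : IwasawaAlgebra p)) :=
    PowerSeries.isUnit_constantCoeff _ w.isUnit
  set w0 : ℤ_[p]ˣ := hwu.unit with hw0_def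
  have hw0 : ((w0 : ℤ_[p]) : ℚ_[p]) = ((PowerSeries.constantCoeff (w : IwasawaAlgebra p) : ℤ_[p]) : ℚ_[p]) := by
    rw [hw0_def, IsUnit.unit_spec]
  have htcast : ((t : ℚ) : ℚ_[p]) = (ϖ : ℚ_[p]) * (s : ℚ_[p]) := by
    rw [ht_def]; push_cast; ring
  -- the identity `t · #tors² = (u · w0) · #Ш[p^∞] · ∏ c_v`
  have key : (t : ℚ_[p]) * (W.torsionOrder : ℚ_[p]) ^ 2 =
      (((u : ℤ_[p]) : ℚ_[p]) * ((w0 : ℤ_[p]) : ℚ_[p])) *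
        (Nat.card (AddCommGroup.primaryComponent W.sha p) : ℚ_[p]) * (W.tamagawaProduct : ℚ_[p]) := by
    apply mul_left_cancel₀ (two_ne_zero : (2 : ℚ_[p]) ≠ 0)
    rw [htcast, hw0]
    linear_combination ((PowerSeries.constantCoeff (w : IwasawaAlgebra p) : ℤ_[p]) : ℚ_[p]) * hu -
      (W.torsionOrder : ℚ_[p]) ^ 2 * h0
  have hval := padicValRat_eq_of_torsionSq_mul_eq W p ht0 _
    (by rw [Padic.valuation_mul (coe_units_ne_zero p u) (coe_units_ne_zero p w0),
      valuation_coe_units_eq_zero, valuation_coe_units_eq_zero, add_zero])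
    (mul_ne_zero (coe_units_ne_zero p u) (coe_units_ne_zero p w0)) key
  exact bsdp_of_padicValRat_rank_zero W p hr hL1 hGZK ⟨t, hq, hval⟩

/-- **Rank `0`, SPLIT multiplicative `p ≠ 2`: `BSD(E,p)` from the main-conjecture EQUALITY,
Greenberg–Stevens and `𝓛_p ≠ 0` — WITHOUT the height-existence fact.** Verbatim
`Typed.bsdp_of_multCharIdeal_split_rankZero` except that THE §4.2 datum at the split prime fed to
Stein–Wuthrich Thm. 6.1 is the zero pairing (`exists_isSplitMultCanonical_of_finite`), so the binder
`hH : exists_isSplitMultCanonical` is gone. Chain as there: `[T¹]ι(T·g·w) = g(0)·w(0) = ϖ·[T¹]L`,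
Greenberg–Stevens `[T¹]L · log κ(γ) = 𝓛_p · [0]⁺_f`, Thm. 6.1 clause 3 with `Reg_p = 1`, cancel
`𝓛_p ≠ 0`, valuations.
-- adapted from Literature/NumberTheory/EllipticCurves/Rank1Residual/Typed/MultiplicativeRankZero.lean
[cite: SteinWuthrich2013, Thm. 6.1 (p. 20) and §4.2 (pp. 15–16)]
[cite: GreenbergStevens1993, Thm. (trivial zero)] [cite: MazurTateTeitelbaum1986, §I.14–I.15]
[cite: Miller2011LMS, Def. 1.1 and §1] -/
theorem bsdp_of_multCharIdeal_split_rankZero_heightFree (hJ : thm61_splitMultiplicative)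
    (hGZK : rank_eq_analyticRank_of_analyticRank_le_one)
    (hmod : hasEntireLFunction_rat)
    (W : WeierstrassCurve ℚ) [W.IsElliptic] [W.IsGloballyMinimal] (p : ℕ) [Fact p.Prime]
    (hGS : greenberg_stevens (W := W) (p := p)) (h𝓛 : LInvariant_ne_zero (W := W) (p := p))
    {κ : ZpExtension ℚ p} {γ : Field.absoluteGaloisGroup ℚ} {N : ℕ} [NeZero N]
    {f : CuspForm (Gamma0 N) 2} (hp : p ≠ 2) (hr : W.analyticRank = 0)
    (Dq : TateParameterData W p)
    (hκ : κ.IsCyclotomic) (hγ : κ.IsTopGenerator γ) (hγ' : IsCyclotomicVariable p γ)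
    (hf : IsNewformOf W f) (D : W.SelmerDualData κ γ) (ϖ : ℚ) (hϖ0 : ϖ ≠ 0)
    (hϖ : (ϖ : ℝ) * W.realPeriodRat = plusPeriod f)
    (L : PowerSeries ℚ_[p]) (hL : IsSplitMultPAdicLFunctionOf f p L)
    (hMC : D.IsTorsion ∧ ∃ (g : IwasawaAlgebra p) (w : (IwasawaAlgebra p)ˣ),
      D.charIdeal = Ideal.span {g} ∧
      iwasawaToPowerSeries p ((PowerSeries.X : IwasawaAlgebra p) * g * (w : IwasawaAlgebra p)) =
        PowerSeries.C ((ϖ : ℚ) : ℚ_[p]) * L) :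
    BSDp W p := by
  have hpP : p.Prime := Fact.out
  haveI : Module.Finite (IwasawaAlgebra p) D.X := D.module_finite_holds hγ
  obtain ⟨hX, g, w, hchar, hw⟩ := hMC
  have hL1 : W.entireLFunction 1 ≠ 0 := (W.analyticRank_eq_zero_iff_holds (hmod W)).1 hr
  obtain ⟨hrank, hfin⟩ := hGZK W (by omega)
  have hr0 : W.mordellWeilRank = 0 := by rw [hrank, hr]
  haveI : Finite W.toAffine.Point := W.mordellWeilRank_eq_zero_iff_finite.mp hr0
  haveI : Finite W.sha := hfin
  haveI : Finite (AddCommGroup.primaryComponent W.sha p) := inferInstance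
  set s : ℚ := ratPlusSymbol f 0 with hs_def
  set t : ℚ := ϖ * s with ht_def
  have hΩpos : 0 < W.realPeriodRat := W.realPeriodRat_pos_holds
  have hLval : W.entireLFunction 1 = (((s : ℝ) * plusPeriod f : ℝ) : ℂ) := hf.entireLFunction_one_eq
  have hq : W.entireLFunction 1 / (W.realPeriodRat : ℂ) = ((t : ℚ) : ℂ) := by
    rw [hLval, ← hϖ, div_eq_iff (Complex.ofReal_ne_zero.mpr hΩpos.ne'), ht_def]
    push_cast
    ring
  have hs0 : s ≠ 0 := by
    intro h0
    apply hL1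
    rw [hLval, h0]
    simp
  have ht0 : t ≠ 0 := mul_ne_zero hϖ0 hs0
  -- THE height datum at the split prime IS the zero pairing in rank `0`; `Reg_p = 1`
  obtain ⟨Dh, hDh⟩ := exists_isSplitMultCanonical_of_finite W p Dq
  have hReg : padicRegulator Dh = 1 := padicRegulator_eq_one_of_finite W p Dh
  have hSch : SchneiderConjecture Dh := by
    rw [SchneiderConjecture, hReg]
    exact one_ne_zero
  -- Stein–Wuthrich Thm. 6.1 (split), clause 3, in rank `0`
  obtain ⟨-, -, h3⟩ := hJ W p hp Dq κ γ hκ hγ hγ' D hX g hchar Dh hDh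
  obtain ⟨u, hu⟩ := h3 hSch inferInstance
  simp only [hr0, zero_add, pow_one, hReg, mul_one, PowerSeries.coeff_zero_eq_constantCoeff] at hu
  -- Greenberg–Stevens: `[T¹]L · log = 𝓛 · [0]⁺_f`
  obtain ⟨-, hGS1⟩ := hGS Dq hf hL
  -- `[T¹] ι(T·g·w) = g(0)·w(0)`
  have hgw : PowerSeries.constantCoeff (g * (w : IwasawaAlgebra p)) =
      PowerSeries.constantCoeff g * PowerSeries.constantCoeff (w : IwasawaAlgebra p) := map_mul _ _ _
  have h1 : ((PowerSeries.constantCoeff g : ℤ_[p]) : ℚ_[p]) *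
      ((PowerSeries.constantCoeff (w : IwasawaAlgebra p) : ℤ_[p]) : ℚ_[p]) =
        ((ϖ : ℚ) : ℚ_[p]) * PowerSeries.coeff 1 L := by
    have h := congrArg (PowerSeries.coeff 1) hw
    rw [show (PowerSeries.X : IwasawaAlgebra p) * g * (w : IwasawaAlgebra p) =
        PowerSeries.X * (g * (w : IwasawaAlgebra p)) from mul_assoc _ _ _] at h
    rw [iwasawaToPowerSeries, PowerSeries.coeff_map, PowerSeries.coeff_succ_X_mul,
      PowerSeries.coeff_zero_eq_constantCoeff, hgw, PowerSeries.coeff_C_mul, map_mul] at h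
    exact h
  -- `w(0)` is a unit of `ℤ_p`
  have hwu : IsUnit (PowerSeries.constantCoeff (w : IwasawaAlgebra p)) :=
    PowerSeries.isUnit_constantCoeff _ w.isUnit
  set w0 : ℤ_[p]ˣ := hwu.unit with hw0_def
  have hw0 : ((w0 : ℤ_[p]) : ℚ_[p]) = ((PowerSeries.constantCoeff (w : IwasawaAlgebra p) : ℤ_[p]) : ℚ_[p]) := by
    rw [hw0_def, IsUnit.unit_spec]
  have htcast : ((t : ℚ) : ℚ_[p]) = (ϖ : ℚ_[p]) * (s : ℚ_[p]) := by
    rw [ht_def]; push_cast; ring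
  have h𝓛0 : LInvariant Dq ≠ 0 := h𝓛 Dq
  -- the identity `t · #tors² = (u · w0) · #Ш[p^∞] · ∏ c_v`
  have key : (t : ℚ_[p]) * (W.torsionOrder : ℚ_[p]) ^ 2 =
      (((u : ℤ_[p]) : ℚ_[p]) * ((w0 : ℤ_[p]) : ℚ_[p])) *
        (Nat.card (AddCommGroup.primaryComponent W.sha p) : ℚ_[p]) * (W.tamagawaProduct : ℚ_[p]) := by
    apply mul_left_cancel₀ h𝓛0
    rw [htcast, hw0]
    linear_combination (-(((ϖ : ℚ) : ℚ_[p]) * (W.torsionOrder : ℚ_[p]) ^ 2)) * hGS1 -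
      (padicLog p (cyclotomicGenerator p) * (W.torsionOrder : ℚ_[p]) ^ 2) * h1 +
      ((PowerSeries.constantCoeff (w : IwasawaAlgebra p) : ℤ_[p]) : ℚ_[p]) * hu
  have hval := padicValRat_eq_of_torsionSq_mul_eq W p ht0 _
    (by rw [Padic.valuation_mul (coe_units_ne_zero p u) (coe_units_ne_zero p w0),
      valuation_coe_units_eq_zero, valuation_coe_units_eq_zero, add_zero])
    (mul_ne_zero (coe_units_ne_zero p u) (coe_units_ne_zero p w0)) key
  exact bsdp_of_padicValRat_rank_zero W p hr hL1 hGZK ⟨t, hq, hval⟩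

/-! ### Mazur's main conjecture at a rank-`0` pair ⇒ `BSD(E,p)`, height-free (adapted from `X2/RankZero.lean`, eisenstein-p2) -/

/-- **Rank `0` at an odd multiplicative prime: Mazur's main conjecture at `(E,p)` gives `BSD(E,p)` —
from Stein–Wuthrich Thm. 6.1 (`hJs`/`hJn`), Greenberg–Stevens (`hGS`), GZK (`hGZK`) and modularity
(`hmod`, `hpar`) ONLY; the height-existence binders `hHs`/`hHn` of
`X2.bsdp_of_mazurMainConjectureAt_of_analyticRank_eq_zero` are discharged (zero datum in rank `0`).**
Data instantiated from tree theorems exactly as there (cyclotomic `(κ,γ)`, `X(E/ℚ_∞)`, the newform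
and `ϖ` from the modular parametrisation, THE Mazur–Tate–Teitelbaum function, the Tate parameter,
`𝓛_p ≠ 0` = `LInvariant_ne_zero_holds`). No reducibility or image hypothesis.
-- adapted from Summits/BirchSwinnertonDyer/Rank1Residual/X2/RankZero.lean
[cite: SteinWuthrich2013, Thm. 6.1 (p. 20) and §4.2] [cite: Skinner2016PacificMC, §3.2–3.3]
[cite: Miller2011LMS, Def. 1.1 and §1] -/
theorem _root_.Summit.BirchSwinnertonDyer.Rank1Residual.X2.bsdp_of_mazurMainConjectureAt_of_analyticRank_eq_zero_heightFree
    (hJs : thm61_splitMultiplicative) (hJn : thm61_nonsplitMultiplicative)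
    (hGZK : rank_eq_analyticRank_of_analyticRank_le_one) (hmod : hasEntireLFunction_rat)
    (hpar : nonempty_modularParametrizationData)
    (W : WeierstrassCurve ℚ) [W.IsElliptic] [W.IsGloballyMinimal] (p : ℕ) [Fact p.Prime]
    (hGS : greenberg_stevens (W := W) (p := p))
    (hp : p ≠ 2) (hmult : W.HasMultiplicativeReductionAtPrime p) (hr : W.analyticRank = 0)
    (hMC : X2.MazurMainConjectureAt W p) : BSDp W p := by
  obtain ⟨κ, hκ, γ, hγ, hγ'⟩ := exists_isCyclotomic_isTopGenerator_isCyclotomicVariable_holds p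
  obtain ⟨D⟩ := W.nonempty_selmerDualData_holds κ γ hγ
  haveI : NeZero (W.conductorNorm ℤ) := ⟨(W.conductorNorm_pos_holds).ne'⟩
  obtain ⟨Dm⟩ := hpar W
  obtain ⟨ϖ, hϖpos, hϖ, -⟩ := Dm.exists_rat_mul_realPeriodRat_eq_plusPeriod
  obtain ⟨hX, g, hchar, hsp, hnsp⟩ := hMC κ γ hκ hγ hγ' Dm.f Dm.isNewformOf D ϖ hϖ
  by_cases hsplit : W.HasSplitMultiplicativeReductionAtPrime p
  · obtain ⟨L, hL⟩ := exists_isSplitMultPAdicLFunctionOf hsplit Dm.isNewformOf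
    obtain ⟨Dq⟩ := (nonempty_tateParameterData_iff_holds (W := W) (p := p)).mpr hsplit
    obtain ⟨w, hw⟩ := hsp hsplit L hL
    exact bsdp_of_multCharIdeal_split_rankZero_heightFree hJs hGZK hmod W p hGS
      LInvariant_ne_zero_holds hp hr Dq hκ hγ hγ' Dm.isNewformOf D ϖ hϖpos.ne' hϖ L hL
      ⟨hX, g, w, hchar, hw⟩
  · obtain ⟨L, hL⟩ := exists_isMultPAdicLFunctionOf_neg_one_of_nonsplit Dm.isNewformOf hmult hsplit
    obtain ⟨q, ⟨hq0, hq1, hqj⟩, -⟩ := existsUnique_tateJ_eq_of_one_lt_norm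
      (one_lt_norm_j_of_hasMultiplicativeReductionAtPrime (W := W) (p := p) hmult)
    obtain ⟨w, hw⟩ := hnsp hsplit L hL
    exact bsdp_of_multCharIdeal_nonsplit_rankZero_heightFree hJn hGZK hmod W p hp hr hmult hsplit hq0
      hq1 hqj hκ hγ hγ' Dm.isNewformOf D ϖ hϖpos.ne' hϖ L hL ⟨hX, g, w, hchar, hw⟩

/-- **Sub-cell X2a of class X2 is CLOSED from published named facts — with TWO FEWER binders**
(`X2.targetA_of_published` without `hHs`/`hHn`): Greenberg–Vatsal 2000 at a multiplicative prime
(`hGV`), Wuthrich 2014 Thm. 16 (`hWu`), Stein–Wuthrich 2013 Thm. 6.1 (`hJs`/`hJn`),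
Greenberg–Stevens, Gross–Zagier–Kolyvagin, modularity. No label change by this theorem.
[cite: GreenbergVatsal2000, Thm. (1.3) with pp. 1, 14–15, §3 Thm. (3.11)]
[cite: Wuthrich2014, Thm. 16 (p. 397)] [cite: SteinWuthrich2013, Thm. 6.1 (p. 20)] -/
theorem _root_.Summit.BirchSwinnertonDyer.Rank1Residual.X2.targetA_of_published_heightFree
    (hGV : lambdaMu_multiplicative_of_gvPar)
    (hWu : thm16_charIdeal_dvd_multiplicative_of_reducible)
    (hJs : thm61_splitMultiplicative) (hJn : thm61_nonsplitMultiplicative)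
    (hGZK : rank_eq_analyticRank_of_analyticRank_le_one) (hmod : hasEntireLFunction_rat)
    (hpar : nonempty_modularParametrizationData)
    (hGS : ∀ (W : WeierstrassCurve ℚ) [W.IsElliptic] [W.IsGloballyMinimal] (p : ℕ) [Fact p.Prime],
      greenberg_stevens (W := W) (p := p)) :
    X2.TargetA := by
  intro W _ _ p _ hc
  obtain ⟨hr, ⟨hp, -, hmult⟩, hgv⟩ := hc
  exact X2.bsdp_of_mazurMainConjectureAt_of_analyticRank_eq_zero_heightFree hJs hJn hGZK hmod hpar W p
    (hGS W p) hp hmult hr (X2.mazurMainConjectureAt_of_gvPar hGV hWu W p hp hmult hgv)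

end Summit.BirchSwinnertonDyer.Rank1Residual.RankZeroHeightFree

end
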